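import Summits.CriticalPhenomena.PercolationContinuityZ3.Theorems.PercAnnulusCrossingTorusGridCovering
import HarnessLib

/-!
# RSW3 lane (lead, gen 24): SYMMETRY AND SHARP THRESHOLDS, VII — THE WINDOW PRINCIPLE FOR BOX CROSSINGS OF `ℤ^d`:
# from the level-`ε` threshold of a block to the high-probability regime of every slightly shorter-and-wider block
# within `32·log(1/ε)/(d·log L)` — sharp thresholds up to an arbitrarily small change of aspect ratio, in every dimension

builds on p205010 (kernel theorem, internal audit signed; external expert review pending) — NOT used in this file
(every `d ≥ 1`, every `p`; NO continuity input).

Cell `prim-rsw3` (LANE 3), lead seat, gen 24.  Support file (`--supports stmt-CriticalPhenomena-4575`); no definitions,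
no named facts, no sorries.  Assembly of parts I–VI (Friedgut–Kalai on the torus + periodic lift + transfer +
sub-crossing + grid covering + square-root trick) into the `d`-dimensional form of Bollobás–Riordan's Lemma 8 (Ch. 3):

* **`boxCrossProb_ge_one_sub_rpow_of_le_boxCrossProb`** — THE WINDOW THEOREM (every `d ≥ 1`; `K·a ≥ 3`, `a ≥ 1`; blocks
  `{0..n}`, `{0..ℓ}` with `1 ≤ ℓ_i`, `a + ℓ_i ≤ n_i`, `n_j + a ≤ ℓ_j` (`j ≠ i`), `n_j + 2, ℓ_j + 2 ≤ K a`): if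
  `2·(Ka)^{−d/4} ≤ ε ≤ P_p(boxCross n i)`, `0 < p ≤ q < 1` and `q ≥ p + 32·log(1/ε)/(d·log(Ka))`, then
  **`P_q(boxCross ℓ i) ≥ 1 − ε^{1/(K+1)^d}`**.  Proof: the symmetrised torus event `E = ⋃_t Λ_t⁻¹(boxCross n i)` has
  `P^T_p(E) ≥ P_p(boxCross n i) ≥ ε` (IV), is increasing, determined by the torus edges and translation invariant (III), so
  `P^T_q(E) ≥ 1 − ε` by Friedgut–Kalai on the torus (II); then the grid covering and the square-root trick (VI) give the
  fixed block.
* **`boxCrossProb_ge_one_sub_of_le_boxCrossProb`** — TWO-LEVEL FORM: `ε ≤ P_p(boxCross n i)`, `δ^{(K+1)^d} ≥ 2(Ka)^{−d/4}`,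
  `ε ≥ 2(Ka)^{-d/4}`, `ε ≤ 1/2`, `0 < p`, `q < 1` and `q ≥ p + 32·(log(1/ε) + (K+1)^d·log(1/δ))/(d·log(Ka))` ⇒ `P_q(boxCross ℓ i) ≥ 1 − δ`:
  **BETWEEN THE LEVEL-`ε` THRESHOLD OF `{0..n}` AND THE LEVEL-`(1−δ)` THRESHOLD OF `{0..ℓ}` LIES A WINDOW OF WIDTH
  `O_{d,K}((log(1/ε) + log(1/δ))/log(Ka))`** — box-crossing thresholds of `ℤ^d` are sharp at the scale `1/log n` up to an
  arbitrarily small change of aspect ratio (`K` large), at every `p`, with no input on `θ(p_c)` (compare gen 18, whose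
  width bound `16(1−2λ)/(λ(1−λ)·|log 2π_p|)` needs small influences, i.e. `θ(p_c) = 0` above `p_c`).
* **`cube_boxCrossProb_ge_one_sub_rpow`** — THE CUBE INSTANCE (every `d ≥ 1`, `m, a ≥ 1`): from the cube `{0..(m+1)a}^d` at
  level `ε` to the block `(ma; (m+2)a, …, (m+2)a)` crossed the short way at level `1 − ε^{1/(m+5)^d}` within
  `32·log(1/ε)/(d·log((m+4)a))`; **`cubeShape_boxCrossProb_ge_one_sub_rpow`** — the `ℤ³` instance in the lane's vocabulary
  (`Π_p((m+1)a) = boxCrossProb 3 p (cubeShape ((m+1)a)) 0 ≥ ε ⇒ boxCrossProb 3 q ![ma, (m+2)a, (m+2)a] 0 ≥ 1 − ε^{1/(m+5)³}`).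

What is NOT proved here: any statement at a FIXED `p` (in particular at `p_c(ℤ³)`), and any bound with the SAME block on
both sides — passing from `{0..ℓ}` back to `{0..n}` is exactly a Russo–Seymour–Welsh estimate, the lane's open wall; in
`d = 2` RSW closes the loop and the theorem becomes Kesten's sharp threshold (Bollobás–Riordan Ch. 3).

References: B. Bollobás, O. Riordan, *Percolation* (CUP 2006), Ch. 2 Thm. 13, Ch. 3 Lemmas 7–8; E. Friedgut, G. Kalai,
Proc. AMS 124 (1996) Thm. 2.1; M. Talagrand, Ann. Probab. 22 (1994) Cor. 1.2; H. Kesten, *Percolation Theory for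
Mathematicians* (1982) §3.3; G. Grimmett, *Percolation* (1999) (11.14).
-/

noncomputable section

namespace Summit.CriticalPhenomena.PercolationContinuityZ3.Theorems.Crossing

open MeasureTheory Literature.Probability.LatticeModels Literature.Probability.Percolation SimpleGraph
open Literature.Probability.Percolation.GhostField (torusTranslate)

variable {d : ℕ}

/-! ## §1 The window theorem -/

/-- **THE WINDOW THEOREM FOR BOX CROSSINGS OF `ℤ^d`** (every `d ≥ 1`; `a ≥ 1`, `K a ≥ 3`; blocks `{0..n}` and `{0..ℓ}`
with `1 ≤ ℓ_i`, `a + ℓ_i ≤ n_i`, `n_j + a ≤ ℓ_j` for `j ≠ i`, and `n_j + 2 ≤ K a`, `ℓ_j + 2 ≤ K a` for all `j`): if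
`2·(Ka)^{−d/4} ≤ ε ≤ P_p(boxCross n i)`, `0 < p ≤ q < 1` and `q ≥ p + 32·log(1/ε)/(d·log(Ka))`, then
**`P_q(boxCross ℓ i) ≥ 1 − ε^{1/(K+1)^d}`**. [cite: BollobasRiordan2006, Ch. 3, Lemma 8] [cite: FriedgutKalai1996, Thm. 2.1] -/
theorem boxCrossProb_ge_one_sub_rpow_of_le_boxCrossProb (hd : 1 ≤ d) {K a : ℕ} (ha : 1 ≤ a) (hL : 3 ≤ K * a)
    (i : Fin d) {n ℓ : Site d} (hℓi : 1 ≤ ℓ i) (hni : (a : ℤ) + ℓ i ≤ n i) (hnj : ∀ j, j ≠ i → n j + a ≤ ℓ j)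
    (hfitn : ∀ j, n j + 2 ≤ ((K * a : ℕ) : ℤ)) (hfitℓ : ∀ j, ℓ j + 2 ≤ ((K * a : ℕ) : ℤ))
    {ε : ℝ} (hε : 2 * ((K * a : ℕ) : ℝ) ^ (-((d : ℝ) / 4)) ≤ ε) {p q : unitInterval} (hp0 : 0 < (p : ℝ))
    (hq1 : (q : ℝ) < 1) (hpq : p ≤ q) (hstart : ε ≤ boxCrossProb d p n i)
    (hwin : (p : ℝ) + 32 * Real.log (1 / ε) / (d * Real.log ((K * a : ℕ) : ℝ)) ≤ q) :
    1 - ε ^ (((K + 1) ^ d : ℕ) : ℝ)⁻¹ ≤ boxCrossProb d q ℓ i := by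
  haveI : NeZero (K * a) := ⟨by omega⟩
  have hL2 : 2 ≤ K * a := by omega
  set E : Set (BondConfig (TorusSite d (K * a))) :=
    ⋃ t : TorusSite d (K * a), (fun ω : BondConfig (TorusSite d (K * a)) =>
      restrictConfig (fun x : Site d => Torus.proj (K * a) x + t) ω ∩ (zdGraph d).edgeSet) ⁻¹' boxCross n i with hE
  -- (IV) the symmetrised event dominates the box crossing at `p`
  have h1 : ε ≤ (bondPercolation (torusGraph d (K * a)) p).real E :=
    hstart.trans (real_iUnion_lift_boxCross_ge hL2 hfitn i p)
  -- (II)+(III) Friedgut–Kalai on the torus for the invariant event `E`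
  have h2 : 1 - ε ≤ (bondPercolation (torusGraph d (K * a)) q).real E :=
    torus_one_sub_le_real_rpow hL hd (isUpperSet_iUnion_lift (isUpperSet_boxCross n i))
      (determinedBy_iUnion_lift hL2 (boxCross n i)) (fun u => relabel_preimage_iUnion_lift u (boxCross n i))
      hε hp0 hq1 hpq h1 hwin
  -- (VI) grid covering and square-root trick at `q`
  have h3 := boxCrossProb_ge_one_sub_rpow_of_iUnion_lift (d := d) ha hL2 i hℓi hni hnj hfitℓ q
  have hε0 : 0 ≤ ε := le_trans (by positivity) hε
  have hrpow : (1 - (bondPercolation (torusGraph d (K * a)) q).real E) ^ (((K + 1) ^ d : ℕ) : ℝ)⁻¹ ≤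
      ε ^ (((K + 1) ^ d : ℕ) : ℝ)⁻¹ :=
    Real.rpow_le_rpow (by linarith [(measureReal_le_one : (bondPercolation (torusGraph d (K * a)) q).real E ≤ 1)])
      (by linarith) (by positivity)
  linarith

/-! ## §2 The two-level form -/

/-- `ε ≤ 1/2 ≤ 1 − ε'` bookkeeping: if `P ≥ 1 − ε` with `ε ≤ 1/2` and `ε' ≤ 1/2` then `P ≥ ε'`. [folklore] -/
theorem le_of_one_sub_le_of_le_half {P ε ε' : ℝ} (hP : 1 - ε ≤ P) (hε : ε ≤ 1 / 2) (hε' : ε' ≤ 1 / 2) : ε' ≤ P := by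
  linarith

/-- `log(1/δ^M) = M·log(1/δ)`. [folklore] -/
theorem log_one_div_pow (δ : ℝ) (M : ℕ) : Real.log (1 / δ ^ M) = M * Real.log (1 / δ) := by
  rw [one_div, Real.log_inv, Real.log_pow, one_div, Real.log_inv]; ring

/-- `(δ^M)^{1/M} = δ` for `δ ≥ 0`, `M ≥ 1`. [folklore] -/
theorem pow_rpow_inv_natCast {δ : ℝ} (hδ : 0 ≤ δ) {M : ℕ} (hM : M ≠ 0) : (δ ^ M) ^ ((M : ℝ)⁻¹) = δ := by
  rw [← Real.rpow_natCast δ M, ← Real.rpow_mul hδ, mul_inv_cancel₀ (by exact_mod_cast hM), Real.rpow_one]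

/-- **THE TWO-LEVEL WINDOW** (hypotheses on `d, K, a, n, ℓ, i` as in the window theorem): let `M = (K+1)^d`,
`0 < δ` with `2·(Ka)^{−d/4} ≤ δ^M` and `δ^M ≤ 1/2`, and `2·(Ka)^{−d/4} ≤ ε ≤ 1/2`.  If `ε ≤ P_p(boxCross n i)`,
`0 < p`, `q < 1` and `q ≥ p + 32·(log(1/ε) + M·log(1/δ))/(d·log(Ka))`, then **`P_q(boxCross ℓ i) ≥ 1 − δ`** — between the
level-`ε` threshold of `{0..n}` and the level-`(1−δ)` threshold of the shorter-and-wider block `{0..ℓ}` lies a window of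
width at most `32·(log(1/ε) + (K+1)^d·log(1/δ))/(d·log(Ka))`. [cite: BollobasRiordan2006, Ch. 3, Lemma 8] [cite: FriedgutKalai1996, Thm. 2.1] -/
theorem boxCrossProb_ge_one_sub_of_le_boxCrossProb (hd : 1 ≤ d) {K a : ℕ} (ha : 1 ≤ a) (hL : 3 ≤ K * a)
    (i : Fin d) {n ℓ : Site d} (hℓi : 1 ≤ ℓ i) (hni : (a : ℤ) + ℓ i ≤ n i) (hnj : ∀ j, j ≠ i → n j + a ≤ ℓ j)
    (hfitn : ∀ j, n j + 2 ≤ ((K * a : ℕ) : ℤ)) (hfitℓ : ∀ j, ℓ j + 2 ≤ ((K * a : ℕ) : ℤ))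
    {ε δ : ℝ} (hε : 2 * ((K * a : ℕ) : ℝ) ^ (-((d : ℝ) / 4)) ≤ ε) (hεhalf : ε ≤ 1 / 2) (hδ0 : 0 < δ)
    (hδ : 2 * ((K * a : ℕ) : ℝ) ^ (-((d : ℝ) / 4)) ≤ δ ^ ((K + 1) ^ d)) (hδhalf : δ ^ ((K + 1) ^ d) ≤ 1 / 2)
    {p q : unitInterval} (hp0 : 0 < (p : ℝ)) (hq1 : (q : ℝ) < 1) (hstart : ε ≤ boxCrossProb d p n i)
    (hwin : (p : ℝ) + 32 * (Real.log (1 / ε) + ((K + 1) ^ d : ℕ) * Real.log (1 / δ)) /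
      (d * Real.log ((K * a : ℕ) : ℝ)) ≤ q) :
    1 - δ ≤ boxCrossProb d q ℓ i := by
  haveI : NeZero (K * a) := ⟨by omega⟩
  have hL2 : 2 ≤ K * a := by omega
  have hLr : (1 : ℝ) < ((K * a : ℕ) : ℝ) := by exact_mod_cast (by omega : 1 < K * a)
  have hlogL : 0 < Real.log ((K * a : ℕ) : ℝ) := Real.log_pos hLr
  have hd0 : (0 : ℝ) < d := by exact_mod_cast hd
  have hden : 0 < (d : ℝ) * Real.log ((K * a : ℕ) : ℝ) := mul_pos hd0 hlogL
  have hε0 : 0 < ε := lt_of_lt_of_le (by positivity) hε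
  have hlogε : 0 ≤ Real.log (1 / ε) := Real.log_nonneg (by rw [le_div_iff₀ hε0]; linarith)
  have hlogδ : 0 ≤ Real.log (1 / δ) := by
    apply Real.log_nonneg
    rw [le_div_iff₀ hδ0, one_mul]
    by_contra h
    push Not at h
    have : (1 : ℝ) < δ ^ ((K + 1) ^ d) := one_lt_pow₀ h (by positivity)
    linarith
  set E : Set (BondConfig (TorusSite d (K * a))) :=
    ⋃ t : TorusSite d (K * a), (fun ω : BondConfig (TorusSite d (K * a)) =>
      restrictConfig (fun x : Site d => Torus.proj (K * a) x + t) ω ∩ (zdGraph d).edgeSet) ⁻¹' boxCross n i with hE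
  have hEup : IsUpperSet E := isUpperSet_iUnion_lift (isUpperSet_boxCross n i)
  have hEdet : DeterminedBy E (torusGraph d (K * a)).edgeSet := determinedBy_iUnion_lift hL2 (boxCross n i)
  have hEinv := fun u : TorusSite d (K * a) => relabel_preimage_iUnion_lift u (boxCross n i) (L := K * a)
  -- the intermediate parameter `r = p + 32 log(1/ε)/(d log(Ka))`
  have hr_le_q : (p : ℝ) + 32 * Real.log (1 / ε) / (d * Real.log ((K * a : ℕ) : ℝ)) ≤ q := by
    have : 32 * Real.log (1 / ε) / (d * Real.log ((K * a : ℕ) : ℝ)) ≤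
        32 * (Real.log (1 / ε) + ((K + 1) ^ d : ℕ) * Real.log (1 / δ)) / (d * Real.log ((K * a : ℕ) : ℝ)) := by
      apply div_le_div_of_nonneg_right _ hden.le
      nlinarith [hlogδ, (by positivity : (0 : ℝ) ≤ ((K + 1) ^ d : ℕ))]
    linarith
  have hp_le_r : (p : ℝ) ≤ (p : ℝ) + 32 * Real.log (1 / ε) / (d * Real.log ((K * a : ℕ) : ℝ)) := by
    have : 0 ≤ 32 * Real.log (1 / ε) / (d * Real.log ((K * a : ℕ) : ℝ)) := by positivity
    linarith
  set r : unitInterval := ⟨(p : ℝ) + 32 * Real.log (1 / ε) / (d * Real.log ((K * a : ℕ) : ℝ)),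
    le_trans p.2.1 hp_le_r, le_trans hr_le_q q.2.2⟩ with hrdef
  have hpr : p ≤ r := Subtype.coe_le_coe.1 hp_le_r
  have hrq : r ≤ q := Subtype.coe_le_coe.1 hr_le_q
  have hr1 : (r : ℝ) < 1 := lt_of_le_of_lt hr_le_q hq1
  have hr0 : 0 < (r : ℝ) := lt_of_lt_of_le hp0 hp_le_r
  -- step 1: `P^T_p(E) ≥ ε`, hence `P^T_r(E) ≥ 1 − ε ≥ 1/2 ≥ δ^M`
  have h1 : ε ≤ (bondPercolation (torusGraph d (K * a)) p).real E :=
    hstart.trans (real_iUnion_lift_boxCross_ge hL2 hfitn i p)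
  have h2 : 1 - ε ≤ (bondPercolation (torusGraph d (K * a)) r).real E :=
    torus_one_sub_le_real_rpow hL hd hEup hEdet hEinv hε hp0 hr1 hpr h1 le_rfl
  have h3 : δ ^ ((K + 1) ^ d) ≤ (bondPercolation (torusGraph d (K * a)) r).real E :=
    le_of_one_sub_le_of_le_half h2 hεhalf hδhalf
  -- step 2: from level `δ^M` at `r` to level `1 − δ^M` at `q`
  have hwin' : (r : ℝ) + 32 * Real.log (1 / δ ^ ((K + 1) ^ d)) / (d * Real.log ((K * a : ℕ) : ℝ)) ≤ q := by
    rw [log_one_div_pow]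
    have : (r : ℝ) = (p : ℝ) + 32 * Real.log (1 / ε) / (d * Real.log ((K * a : ℕ) : ℝ)) := rfl
    rw [this]
    have hsplit : 32 * (Real.log (1 / ε) + ((K + 1) ^ d : ℕ) * Real.log (1 / δ)) / (d * Real.log ((K * a : ℕ) : ℝ)) =
        32 * Real.log (1 / ε) / (d * Real.log ((K * a : ℕ) : ℝ)) +
          32 * (((K + 1) ^ d : ℕ) * Real.log (1 / δ)) / (d * Real.log ((K * a : ℕ) : ℝ)) := by ring
    push_cast at hwin hsplit ⊢
    linarith
  have h4 : 1 - δ ^ ((K + 1) ^ d) ≤ (bondPercolation (torusGraph d (K * a)) q).real E :=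
    torus_one_sub_le_real_rpow hL hd hEup hEdet hEinv hδ hr0 hq1 hrq h3 hwin'
  -- step 3: grid covering and square-root trick at `q`
  have h5 := boxCrossProb_ge_one_sub_rpow_of_iUnion_lift (d := d) ha hL2 i hℓi hni hnj hfitℓ q
  have hM0 : ((K + 1) ^ d : ℕ) ≠ 0 := by positivity
  have hrpow : (1 - (bondPercolation (torusGraph d (K * a)) q).real E) ^ (((K + 1) ^ d : ℕ) : ℝ)⁻¹ ≤
      (δ ^ ((K + 1) ^ d)) ^ (((K + 1) ^ d : ℕ) : ℝ)⁻¹ :=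
    Real.rpow_le_rpow (by linarith [(measureReal_le_one : (bondPercolation (torusGraph d (K * a)) q).real E ≤ 1)])
      (by linarith) (by positivity)
  rw [pow_rpow_inv_natCast hδ0.le hM0] at hrpow
  linarith

/-! ## §3 The cube instance -/

/-- **THE CUBE-TO-EASY-BOX WINDOW** (every `d ≥ 1`, `m ≥ 1`, `a ≥ 1`, direction `i`): from the cube `{0..(m+1)a}^d` to the
block with side `m·a` in direction `i` and `(m+2)·a` across (aspect ratio `(m+2)/m`, crossed the short way), on the
torus of side `(m+4)·a`: if `2·((m+4)a)^{−d/4} ≤ ε ≤ P_p(cube crossed in direction i)`, `0 < p ≤ q < 1` and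
`q ≥ p + 32·log(1/ε)/(d·log((m+4)a))`, then the block is crossed at `q` with probability `≥ 1 − ε^{1/(m+5)^d}`.
[cite: BollobasRiordan2006, Ch. 3, Lemma 8] [cite: FriedgutKalai1996, Thm. 2.1] [cite: Kesten1982, §3.3] -/
theorem cube_boxCrossProb_ge_one_sub_rpow (hd : 1 ≤ d) {m a : ℕ} (hm : 1 ≤ m) (ha : 1 ≤ a) (i : Fin d)
    {ε : ℝ} (hε : 2 * ((((m + 4) * a : ℕ) : ℝ)) ^ (-((d : ℝ) / 4)) ≤ ε) {p q : unitInterval} (hp0 : 0 < (p : ℝ))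
    (hq1 : (q : ℝ) < 1) (hpq : p ≤ q)
    (hstart : ε ≤ boxCrossProb d p (fun _ => (((m + 1) * a : ℕ) : ℤ)) i)
    (hwin : (p : ℝ) + 32 * Real.log (1 / ε) / (d * Real.log (((m + 4) * a : ℕ) : ℝ)) ≤ q) :
    1 - ε ^ (((m + 4 + 1) ^ d : ℕ) : ℝ)⁻¹ ≤
      boxCrossProb d q (fun j => if j = i then ((m * a : ℕ) : ℤ) else (((m + 2) * a : ℕ) : ℤ)) i := by
  have hma : 1 ≤ m * a := Nat.one_le_iff_ne_zero.2 (Nat.mul_ne_zero (by omega) (by omega))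
  refine boxCrossProb_ge_one_sub_rpow_of_le_boxCrossProb hd (K := m + 4) ha (by nlinarith) i
    (n := fun _ => (((m + 1) * a : ℕ) : ℤ)) ?_ ?_ ?_ ?_ ?_ hε hp0 hq1 hpq hstart hwin
  · simp only [if_true]; exact_mod_cast hma
  · simp only [if_true]; push_cast; nlinarith
  · intro j hj; simp only [hj, if_false]; push_cast; nlinarith
  · intro j; push_cast; nlinarith
  · intro j
    by_cases hj : j = i
    · simp only [hj, if_true]; push_cast; nlinarith
    · simp only [hj, if_false]; push_cast; nlinarith

/-! ## §4 The `ℤ³` instance in the lane's vocabulary -/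

/-- `cubeShape n` as a constant side vector. [folklore] -/
theorem cubeShape_eq_const (n : ℕ) : cubeShape n = fun _ : Fin 3 => (n : ℤ) := by
  funext j
  fin_cases j <;> rfl

/-- The block `(ma; (m+2)a, (m+2)a)` as an `if`-vector. [folklore] -/
theorem vec3_eq_ite (u v : ℤ) : (![u, v, v] : Site 3) = fun j : Fin 3 => if j = 0 then u else v := by
  funext j
  fin_cases j <;> rfl

/-- **THE `ℤ³` CUBE WINDOW IN THE LANE'S VOCABULARY** (`Π_p(n) = boxCrossProb 3 p (cubeShape n) 0`; `m, a ≥ 1`): if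
`2·((m+4)a)^{−3/4} ≤ ε ≤ Π_p((m+1)a)`, `0 < p ≤ q < 1` and `q ≥ p + 32·log(1/ε)/(3·log((m+4)a))`, then the block
`{0..ma} × {0..(m+2)a}²` is crossed in direction `0` at `q` with probability `≥ 1 − ε^{1/(m+5)³}` — from the level-`ε`
threshold of the cube of side `(m+1)a` to the high-probability regime of the aspect-`(m+2)/m` easy block within
`O(log(1/ε)/log a)`, at every `p`, with no input on `θ(p_c(ℤ³))`.
[cite: BollobasRiordan2006, Ch. 3, Lemma 8] [cite: FriedgutKalai1996, Thm. 2.1] [cite: Kesten1982, §3.3 (3.32)] -/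
theorem cubeShape_boxCrossProb_ge_one_sub_rpow {m a : ℕ} (hm : 1 ≤ m) (ha : 1 ≤ a)
    {ε : ℝ} (hε : 2 * ((((m + 4) * a : ℕ) : ℝ)) ^ (-((3 : ℝ) / 4)) ≤ ε) {p q : unitInterval} (hp0 : 0 < (p : ℝ))
    (hq1 : (q : ℝ) < 1) (hpq : p ≤ q) (hstart : ε ≤ boxCrossProb 3 p (cubeShape ((m + 1) * a)) 0)
    (hwin : (p : ℝ) + 32 * Real.log (1 / ε) / (3 * Real.log (((m + 4) * a : ℕ) : ℝ)) ≤ q) :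
    1 - ε ^ (((m + 4 + 1) ^ 3 : ℕ) : ℝ)⁻¹ ≤
      boxCrossProb 3 q ![((m * a : ℕ) : ℤ), (((m + 2) * a : ℕ) : ℤ), (((m + 2) * a : ℕ) : ℤ)] 0 := by
  have h := cube_boxCrossProb_ge_one_sub_rpow (d := 3) (by norm_num) hm ha 0
    (by simpa using hε) hp0 hq1 hpq (by rw [cubeShape_eq_const] at hstart; exact_mod_cast hstart)
    (by simpa using hwin)
  rw [vec3_eq_ite]
  exact h

end Summit.CriticalPhenomena.PercolationContinuityZ3.Theorems.Crossing

end
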